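import Mathlib
import Summits.Ventures.HodgeRepro.Tier4.Line4.CentreFinDomain

/-!
# Tier4/Line4/CentreCocompact — `Z(k)\Z(𝔸)` compact ⇒ `Z(k)\Z_f` compact: the `hZc` input of C-L4-ZDOMAIN-EX reduced to
the standard cocompactness of the rational points of the centre in `Z(𝔸)`

Blind re-derivation cell `pub-hodge-repro`, Tier 4 «prove the step» (README §9–§10), LINE L4 helper on the planner's
word (t4-plan-4 g3; offer t4-typer-2 g4, bus S14705), seat t4-typer-2 (gen 4).  Target tree path
`lean/Summits/Ventures/HodgeRepro/Tier4/Line4/CentreCocompact.lean`.  Imports: Mathlib and `Line4.CentreFinDomain`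
(t4-L2-p2 g4, p696615: `finTfHom`, `centreFin`, `ZfIn`, `coe_coe_finTfHom`, `continuous_finTfHom`) — through it
`Line4.TorusProduct` (`torusFin`, `ofFinPart_eq_self_of_mem_finitePart`, `infM_eq_one_of_mem_finitePart`),
`Line4.OrbitalUnfoldCentralCosets` (`rationalCentreT`), `Line4.FinitePlacePositivity` (`ofFinPart_mem_torusT(')`),
`Line1.FiniteLevelIsolation` / `Line1.AdelicParts` (`GA.ofFinPart`, `mixM`, `M4_ext`).

WHY (plan-4 g3, bus S14455 Part 6 (iv) / S14687): after C-L4-ZDOMAIN-EX the one displayed input of the `Z(k)`-domain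
is `hZc : ∃ E compact ⊆ Z_f, Z_f ⊆ Z(k) · E` («`Z(k)\Z_f` compact»).  The PRINT behind it is the cocompactness of the
rational points of the anisotropic torus `Z = U(1)_{E′/k}` in `Z(𝔸)` (Ono; Godement, Sém. Bourbaki 257 §3 Thm 2,
lit-5 row I-t4-lit-5-67), which lives in `T(𝔸)`, not in `T_f`.  Here the passage to the finite part is a THEOREM:
* `isClosed_center_GA`, `isClosed_centre`, `isClosed_centre_subgroupOf_torusT` — `Z(𝔸)` is closed;
* `commute_of_mem_infinitePart_of_mem_finitePart` — `G_∞` and `G_f` commute elementwise;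
* `ofFinPart_mem_center`, `ofFinPart_mem_centre` — the finite part of a central element is central (compare the
  finite parts of `g z = z g`), and lies in `T`, `T′`;
* `finTfHom_coe_eq_self` — `finTfHom` is the identity on `T_f`;
* **`exists_compact_centreFin_mul_of_cocompact`** — from `Z(𝔸) ⊆ Z(k) · L`, `L` compact in `T(𝔸)`, the set
  `E := finTfHom '' (L ∩ Z(𝔸))` is compact, lies in `Z_f`, and `Z_f ⊆ Z(k)_f · E`: exactly the `hZc` clause of
  `exists_isFundamentalDomain_centreFin`.
So `hZc` is discharged by the display `hZ : ∃ L, IsCompact L ∧ Z(𝔸) ⊆ Z(k) · L` — the printed statement in the cell's own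
vocabulary; the compact-lifting (Bourbaki TG III §4.5 Prop 10, row -64) is not needed.  Junk test: `L = ∅` makes `hZ`
false unless `Z(𝔸) = ∅`, impossible (`1 ∈ Z(𝔸)`); `E` is non-empty.

Nothing here says anything about the status of the Hodge conjecture for CM abelian varieties, which is NOT proved
(HC_CM is NOT proved by anyone in this repository).
-/

set_option autoImplicit false

noncomputable section

namespace Summit.Ventures.HodgeRepro.Tier4.Line4

open Summit.Ventures.HodgeRepro.Tier4 Summit.Ventures.HodgeRepro.Tier4.Common
  Summit.Ventures.HodgeRepro.Tier4.Line1
open Set Topology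
open scoped Pointwise

variable {k : Type} [Field k] [NumberField k] (W : PlaneData k)

/-- The centre of `G(𝔸)` is closed (`G(𝔸)` is Hausdorff: `⋂ g, {x | g x = x g}`). -/
theorem isClosed_center_GA : IsClosed (Subgroup.center (GA W) : Set (GA W)) := by
  haveI := t2Space_GA W
  have h : (Subgroup.center (GA W) : Set (GA W)) = ⋂ g : GA W, {x : GA W | g * x = x * g} := by
    ext x
    simp only [SetLike.mem_coe, Subgroup.mem_center_iff, Set.mem_iInter, Set.mem_setOf_eq]
  rw [h]
  exact isClosed_iInter fun g => isClosed_eq (continuous_const.mul continuous_id) (continuous_id.mul continuous_const)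

/-- `Z(𝔸) = T ⊓ T′ ⊓ Z(G(𝔸))` is closed in `G(𝔸)`. -/
theorem isClosed_centre : IsClosed (centre W : Set (GA W)) := by
  rw [centre, Subgroup.coe_inf, Subgroup.coe_inf]
  exact ((Common.isClosed_torusT W).inter (Common.isClosed_torusT' W)).inter (isClosed_center_GA W)

/-- `Z(𝔸)` is closed in `T(𝔸)`. -/
theorem isClosed_centre_subgroupOf_torusT :
    IsClosed (((centre W).subgroupOf (torusT W) : Subgroup (torusT W)) : Set (torusT W)) := by
  rw [Subgroup.coe_subgroupOf]
  exact (isClosed_centre W).preimage continuous_subtype_val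

/-- `G_∞` and `G_f` commute elementwise (the two parts of the matrices are disjoint). -/
theorem commute_of_mem_infinitePart_of_mem_finitePart {g h : GA W} (hg : g ∈ infinitePart W)
    (hh : h ∈ finitePart W) : g * h = h * g := by
  apply Subtype.ext
  apply Units.ext
  change GA.mat W g * GA.mat W h = GA.mat W h * GA.mat W g
  apply M4_ext
  · rw [infM_mul, infM_mul, infM_eq_one_of_mem_finitePart W hh, Matrix.mul_one, Matrix.one_mul]
  · rw [finM_mul, finM_mul, (mem_infinitePart W g).1 hg, Matrix.mul_one, Matrix.one_mul]

/-- **The finite part of a central element is central**: compare the finite parts of `g z = z g`. -/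
theorem ofFinPart_mem_center {z : GA W} (hz : z ∈ Subgroup.center (GA W)) :
    GA.ofFinPart W z ∈ Subgroup.center (GA W) := by
  rw [Subgroup.mem_center_iff] at hz ⊢
  intro g
  have hfin : finM k (GA.mat W g) * finM k (GA.mat W z) = finM k (GA.mat W z) * finM k (GA.mat W g) := by
    have h := congrArg (fun x : GA W => finM k (GA.mat W x)) (hz g)
    simpa only [GA.mat_mul, finM_mul] using h
  apply Subtype.ext
  apply Units.ext
  change GA.mat W g * GA.mat W (GA.ofFinPart W z) = GA.mat W (GA.ofFinPart W z) * GA.mat W g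
  rw [GA.mat_ofFinPart]
  apply M4_ext
  · simp only [infM_mul, infM_mixM, Matrix.mul_one, Matrix.one_mul]
  · rw [finM_mul, finM_mul, finM_mixM]
    exact hfin

/-- The finite part of an element of `Z(𝔸)` lies in `Z(𝔸)`. -/
theorem ofFinPart_mem_centre {z : GA W} (hz : z ∈ centre W) : GA.ofFinPart W z ∈ centre W :=
  ⟨⟨ofFinPart_mem_torusT W hz.1.1, ofFinPart_mem_torusT' W hz.1.2⟩, ofFinPart_mem_center W hz.2⟩

/-- `finTfHom` is the identity on `T_f`. -/
theorem finTfHom_coe_eq_self (z : torusFin W) : finTfHom W (z : torusT W) = z := by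
  apply Subtype.ext
  apply Subtype.ext
  rw [coe_coe_finTfHom]
  exact ofFinPart_eq_self_of_mem_finitePart W (coe_coe_mem_finitePart W z)

/-- **`Z(k)\Z(𝔸)` compact ⇒ `Z(k)\Z_f` compact — the `hZc` clause of C-L4-ZDOMAIN-EX from the standard cocompactness
in `T(𝔸)`**: if `Z(𝔸) ⊆ Z(k) · L` with `L` compact, then `E := finTfHom '' (L ∩ Z(𝔸))` is compact, lies in `Z_f`
(the finite part of a central element is central), and `Z_f ⊆ Z(k)_f · E` (`z = γ l` with `l = γ⁻¹ z ∈ L ∩ Z(𝔸)`,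
and `finTfHom z = z` on `T_f`). -/
theorem exists_compact_centreFin_mul_of_cocompact
    (hZ : ∃ L : Set (torusT W), IsCompact L ∧
      (((centre W).subgroupOf (torusT W) : Subgroup (torusT W)) : Set (torusT W)) ⊆
        (rationalCentreT W : Set (torusT W)) * L) :
    ∃ E : Set (torusFin W), IsCompact E ∧ E ⊆ (ZfIn W : Set (torusFin W)) ∧
      (ZfIn W : Set (torusFin W)) ⊆ (centreFin W : Set (torusFin W)) * E := by
  obtain ⟨L, hL, hZL⟩ := hZ
  set Zc : Subgroup (torusT W) := (centre W).subgroupOf (torusT W) with hZc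
  refine ⟨finTfHom W '' (L ∩ (Zc : Set (torusT W))),
    (hL.inter_right (isClosed_centre_subgroupOf_torusT W)).image (continuous_finTfHom W), ?_, ?_⟩
  · rintro _ ⟨l, ⟨-, hlZ⟩, rfl⟩
    show finTfHom W l ∈ ZfIn W
    rw [ZfIn, Subgroup.mem_subgroupOf, Subgroup.mem_subgroupOf, coe_coe_finTfHom]
    exact ofFinPart_mem_centre W (Subgroup.mem_subgroupOf.1 hlZ)
  · intro z hz
    have hzZ : (z : torusT W) ∈ Zc := Subgroup.mem_subgroupOf.1 hz
    obtain ⟨γ, hγ, l, hl, hγl⟩ := hZL hzZ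
    have hγl' : γ * l = (z : torusT W) := hγl
    have hγZ : γ ∈ Zc := (Subgroup.mem_inf.1 hγ).2
    have hlZ : l ∈ Zc := by
      have : l = γ⁻¹ * (z : torusT W) := by rw [← hγl', inv_mul_cancel_left]
      rw [this]
      exact Zc.mul_mem (Zc.inv_mem hγZ) hzZ
    refine ⟨finTfHom W γ, Subgroup.mem_map.2 ⟨γ, hγ, rfl⟩, finTfHom W l, ⟨l, ⟨hl, hlZ⟩, rfl⟩, ?_⟩
    show finTfHom W γ * finTfHom W l = z
    rw [← map_mul, hγl']
    exact finTfHom_coe_eq_self W z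

end Summit.Ventures.HodgeRepro.Tier4.Line4

end
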